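import Mathlib
import HarnessLib
import Summits.Ventures.LatticeQCDFlow.Scaling.TorusClosingSection
import Summits.Ventures.LatticeQCDFlow.Scaling.BoxRankedMorseCount

/-!
# LatticeQCDFlow / Scaling — CLOSING SECTIONS INSIDE A BLOCK: an optimal ranked structure of a block `K`
# has a closing section inside `K` of size `s` with `(2d−3)·s ≥ #(K ∖ B)`; in the box of `(ℤ/L)³`,
# `(R−1)³ ≤ 3s`

HONEST FRAMING: exact (Metropolis-corrected) sampling algorithms for lattice gauge theory;
figures of merit are autocorrelation/cost numbers at stated couplings and volumes; no
continuum-physics claim.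

Venture `LatticeQCDFlow` (cell pub-lqcd), topic `Scaling`, FANOUT row 30 (lean-1, GEN-26) — OUR WORK on
THEORY-2.md §4 row C5, the free-boundary companion of `Scaling/TorusClosingSection`.  GEN-25's
`BoxRankedMorseBound`/`BoxRankedMorseCount` determined the least number of plaquettes of a box `K` that no
ranked structure `B ⊆ K` covers (`(R−1)³` in `d = 3`, one per unit cube; `0` in `d = 2`).  For the FLOOR of
the free-boundary sampler (`Scaling/BoxPeelingClosingBound` and its sequel) one needs a closing section
INSIDE the block:

* §1 **`exists_topLink_mem_of_blockOptimal`** — if `B ⊆ K` is ranked and no ranked `B' ⊆ K` leaves fewer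
  plaquettes of `K` outside, then every `p' ∈ K ∖ B` carries the top link of a covered plaquette;
* §2 **`exists_closingSection_block`** — for an injective rank, the plaquettes of `K ∖ B` carrying a top link
  admit a closing section `S ⊆ K` with `#{…} ≤ (2(d−1) − 1)·#S`;
* §3 **`exists_closingSection_of_blockOptimal`** — hence an optimal `B ⊆ K` has, for a refined rank, a
  closing section `S ⊆ K ∖ B` with `#(K ∖ B) ≤ (2(d−1) − 1)·#S`; **`exists_boxOptimal_closingSection_three`**
  — the box of side `R` of `(ℤ/L)³` (`1 ≤ R`, `R + 1 ≤ L`): a ranked `B ⊆ K` with `#(K ∖ B) = (R−1)³` and a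
  closing section inside `K` with `(R−1)³ ≤ 3s`.

No `def`, no `sorry`, nothing cited as a fact.
-/

namespace Summit.Ventures.LatticeQCDFlow.Theory2.Autoregressive

open Finset Function
open Literature.MathematicalPhysics.QuantumFieldTheory Literature.MathematicalPhysics.QuantumLattice

variable {d L : ℕ} [NeZero L]

/-! ## §1 In an optimal structure of a block every uncovered block plaquette carries a top link -/

omit [NeZero L] in
/-- **Every uncovered plaquette of a block-optimal ranked structure carries a top link.**  `B ⊆ K` ranked,
and `#(K ∖ B) ≤ #(K ∖ B')` for every ranked `B' ⊆ K`.  Then every `p' ∈ K ∖ B` contains the top link of some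
`p ∈ B` (else adjoin `p'` with a fresh top link and the lowest rank). [ours] -/
theorem exists_topLink_mem_of_blockOptimal (K B : Finset (Plaquette d L)) (hBK : B ⊆ K)
    (t : Plaquette d L → Edge d L)
    (ht : ∀ p ∈ B, t p ∈ ({(p.1, p.2.1.1), (p.1.shift p.2.1.1, p.2.1.2),
        (p.1.shift p.2.1.2, p.2.1.1), (p.1, p.2.1.2)} : Finset (Edge d L)))
    (rank : Plaquette d L → ℕ)
    (hrank : ∀ p ∈ B, ∀ p' ∈ B, p ≠ p' → t p ∈ ({(p'.1, p'.2.1.1), (p'.1.shift p'.2.1.1, p'.2.1.2),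
        (p'.1.shift p'.2.1.2, p'.2.1.1), (p'.1, p'.2.1.2)} : Finset (Edge d L)) → rank p < rank p')
    (hopt : ∀ (B' : Finset (Plaquette d L)) (t' : Plaquette d L → Edge d L) (rank' : Plaquette d L → ℕ),
      B' ⊆ K →
      (∀ p ∈ B', t' p ∈ ({(p.1, p.2.1.1), (p.1.shift p.2.1.1, p.2.1.2),
        (p.1.shift p.2.1.2, p.2.1.1), (p.1, p.2.1.2)} : Finset (Edge d L))) →
      (∀ p ∈ B', ∀ p' ∈ B', p ≠ p' → t' p ∈ ({(p'.1, p'.2.1.1), (p'.1.shift p'.2.1.1, p'.2.1.2),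
        (p'.1.shift p'.2.1.2, p'.2.1.1), (p'.1, p'.2.1.2)} : Finset (Edge d L)) → rank' p < rank' p') →
      (K \ B).card ≤ (K \ B').card)
    {p' : Plaquette d L} (hp'K : p' ∈ K) (hp' : p' ∉ B) :
    ∃ p ∈ B, t p ∈ ({(p'.1, p'.2.1.1), (p'.1.shift p'.2.1.1, p'.2.1.2),
        (p'.1.shift p'.2.1.2, p'.2.1.1), (p'.1, p'.2.1.2)} : Finset (Edge d L)) := by
  classical
  by_contra hno
  push Not at hno
  set B' : Finset (Plaquette d L) := insert p' B with hB'
  set t' : Plaquette d L → Edge d L := Function.update t p' (p'.1, p'.2.1.1) with ht'def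
  set rank' : Plaquette d L → ℕ := fun p => if p = p' then 0 else rank p + 1 with hrank'def
  have hne_of_mem : ∀ p ∈ B, p ≠ p' := fun p hp h => hp' (h ▸ hp)
  have hB'K : B' ⊆ K := Finset.insert_subset hp'K hBK
  have ht' : ∀ p ∈ B', t' p ∈ ({(p.1, p.2.1.1), (p.1.shift p.2.1.1, p.2.1.2),
      (p.1.shift p.2.1.2, p.2.1.1), (p.1, p.2.1.2)} : Finset (Edge d L)) := by
    intro p hp
    rcases Finset.mem_insert.1 hp with rfl | hpB
    · simp [ht'def]
    · rw [ht'def, Function.update_of_ne (hne_of_mem p hpB)]; exact ht p hpB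
  have hrank' : ∀ p ∈ B', ∀ q ∈ B', p ≠ q → t' p ∈ ({(q.1, q.2.1.1), (q.1.shift q.2.1.1, q.2.1.2),
      (q.1.shift q.2.1.2, q.2.1.1), (q.1, q.2.1.2)} : Finset (Edge d L)) → rank' p < rank' q := by
    intro p hp q hq hne hmem
    rcases Finset.mem_insert.1 hp with rfl | hpB <;> rcases Finset.mem_insert.1 hq with rfl | hqB
    · exact absurd rfl hne
    · have hq' := hne_of_mem q hqB
      simp [hrank'def, hq']
    · have hp'' := hne_of_mem p hpB
      rw [ht'def, Function.update_of_ne hp''] at hmem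
      exact absurd hmem (hno p hpB)
    · have hp'' := hne_of_mem p hpB
      have hq'' := hne_of_mem q hqB
      rw [ht'def, Function.update_of_ne hp''] at hmem
      have h := hrank p hpB q hqB hne hmem
      simp only [hrank'def, hp'', hq'', if_false]
      omega
  have hle := hopt B' t' rank' hB'K ht' hrank'
  have hmem' : p' ∈ K \ B := Finset.mem_sdiff.2 ⟨hp'K, hp'⟩
  have hsd : K \ B' = (K \ B).erase p' := by
    ext q
    simp only [hB', Finset.mem_sdiff, Finset.mem_insert, not_or, Finset.mem_erase]
    tauto
  rw [hsd, Finset.card_erase_of_mem hmem'] at hle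
  have : 0 < (K \ B).card := Finset.card_pos.2 ⟨p', hmem'⟩
  omega

/-! ## §2 Closing sections inside a block -/

/-- **Closing sections inside a block.**  `(B, t, rank)` ranked with `rank` injective on `B`; `T` the
plaquettes of `K ∖ B` carrying a top link.  Then some `S ⊆ T` and `u` form a closing section
(`u p' ∈ B`, `t (u p')` a link of `p'`, `rank p < rank (u p')` for every other covered `p` whose top link
lies on `p'`, `u` injective on `S`) with `#T ≤ (2(d−1) − 1)·#S`. [ours] -/
theorem exists_closingSection_block (K B : Finset (Plaquette d L)) (t : Plaquette d L → Edge d L)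
    (ht : ∀ p ∈ B, t p ∈ ({(p.1, p.2.1.1), (p.1.shift p.2.1.1, p.2.1.2),
        (p.1.shift p.2.1.2, p.2.1.1), (p.1, p.2.1.2)} : Finset (Edge d L)))
    (rank : Plaquette d L → ℕ) (hrinj : Set.InjOn rank B) :
    ∃ (S : Finset (Plaquette d L)) (u : Plaquette d L → Plaquette d L),
      (∀ p' ∈ S, p' ∈ K) ∧ (∀ p' ∈ S, p' ∉ B) ∧ (∀ p' ∈ S, u p' ∈ B) ∧
      (∀ p' ∈ S, t (u p') ∈ ({(p'.1, p'.2.1.1), (p'.1.shift p'.2.1.1, p'.2.1.2),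
        (p'.1.shift p'.2.1.2, p'.2.1.1), (p'.1, p'.2.1.2)} : Finset (Edge d L))) ∧
      (∀ p' ∈ S, ∀ p ∈ B, p ≠ u p' → t p ∈ ({(p'.1, p'.2.1.1), (p'.1.shift p'.2.1.1, p'.2.1.2),
        (p'.1.shift p'.2.1.2, p'.2.1.1), (p'.1, p'.2.1.2)} : Finset (Edge d L)) → rank p < rank (u p')) ∧
      Set.InjOn u S ∧
      ((K \ B).filter (fun p' => ∃ p ∈ B, t p ∈ ({(p'.1, p'.2.1.1),
        (p'.1.shift p'.2.1.1, p'.2.1.2), (p'.1.shift p'.2.1.2, p'.2.1.1), (p'.1, p'.2.1.2)} :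
          Finset (Edge d L)))).card ≤ (2 * (d - 1) - 1) * S.card := by
  classical
  set T : Finset (Plaquette d L) := (K \ B).filter (fun p' => ∃ p ∈ B, t p ∈ ({(p'.1, p'.2.1.1),
    (p'.1.shift p'.2.1.1, p'.2.1.2), (p'.1.shift p'.2.1.2, p'.2.1.1), (p'.1, p'.2.1.2)} :
      Finset (Edge d L))) with hT
  have hex : ∀ p', p' ∈ T → ∃ p, p ∈ B ∧ t p ∈ ({(p'.1, p'.2.1.1), (p'.1.shift p'.2.1.1, p'.2.1.2),
      (p'.1.shift p'.2.1.2, p'.2.1.1), (p'.1, p'.2.1.2)} : Finset (Edge d L)) ∧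
      ∀ q ∈ B, t q ∈ ({(p'.1, p'.2.1.1), (p'.1.shift p'.2.1.1, p'.2.1.2),
        (p'.1.shift p'.2.1.2, p'.2.1.1), (p'.1, p'.2.1.2)} : Finset (Edge d L)) → rank q ≤ rank p := by
    intro p' hp'
    obtain ⟨-, p₀, hp₀, hp₀m⟩ := Finset.mem_filter.1 hp'
    obtain ⟨p, hpC, hpmax⟩ := Finset.exists_max_image (B.filter (fun p => t p ∈ ({(p'.1, p'.2.1.1),
      (p'.1.shift p'.2.1.1, p'.2.1.2), (p'.1.shift p'.2.1.2, p'.2.1.1), (p'.1, p'.2.1.2)} :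
        Finset (Edge d L)))) rank ⟨p₀, Finset.mem_filter.2 ⟨hp₀, hp₀m⟩⟩
    exact ⟨p, (Finset.mem_filter.1 hpC).1, (Finset.mem_filter.1 hpC).2,
      fun q hq hqm => hpmax q (Finset.mem_filter.2 ⟨hq, hqm⟩)⟩
  choose! u huB hut humax using hex
  have hsec : ∀ a, a ∈ T.image u → ∃ p', p' ∈ T ∧ u p' = a := fun a ha => by
    simpa only [Finset.mem_image] using ha
  choose! g hgT hug using hsec
  have hST : ∀ p' ∈ (T.image u).image g, p' ∈ T := by
    intro p' hp'
    obtain ⟨a, ha, rfl⟩ := Finset.mem_image.1 hp'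
    exact hgT a ha
  have hTK : ∀ p' ∈ T, p' ∈ K := fun p' hp' => (Finset.mem_sdiff.1 (Finset.mem_filter.1 hp').1).1
  have hTB : ∀ p' ∈ T, p' ∉ B := fun p' hp' => (Finset.mem_sdiff.1 (Finset.mem_filter.1 hp').1).2
  refine ⟨(T.image u).image g, u, fun p' hp' => hTK p' (hST p' hp'), fun p' hp' => hTB p' (hST p' hp'),
    fun p' hp' => huB p' (hST p' hp'), fun p' hp' => hut p' (hST p' hp'), ?_, ?_, ?_⟩
  · intro p' hp' p hp hne hmem
    have hT' := hST p' hp'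
    exact lt_of_le_of_ne (humax p' hT' p hp hmem) fun h => hne (hrinj hp (huB p' hT') h)
  · intro x hx y hy hxy
    obtain ⟨a, ha, rfl⟩ := Finset.mem_image.1 hx
    obtain ⟨b, hb, rfl⟩ := Finset.mem_image.1 hy
    rw [hug a ha, hug b hb] at hxy
    rw [hxy]
  · have hginj : Set.InjOn g (T.image u) := fun a ha b hb h => by rw [← hug a ha, ← hug b hb, h]
    rw [Finset.card_image_of_injOn hginj]
    have hfib : ∀ a ∈ T.image u, (T.filter (fun p' => u p' = a)).card ≤ 2 * (d - 1) - 1 := by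
      intro a ha
      obtain ⟨p₁, hp₁, hp₁a⟩ := Finset.mem_image.1 ha
      have haB : a ∈ B := hp₁a ▸ huB p₁ hp₁
      have hsub : T.filter (fun p' => u p' = a) ⊆
          ((Finset.univ : Finset (Plaquette d L)).filter (fun p => t a ∈ ({(p.1, p.2.1.1),
            (p.1.shift p.2.1.1, p.2.1.2), (p.1.shift p.2.1.2, p.2.1.1), (p.1, p.2.1.2)} :
              Finset (Edge d L)))).erase a := by
        intro p' hp'
        obtain ⟨hp'T, hp'a⟩ := Finset.mem_filter.1 hp'
        refine Finset.mem_erase.2 ⟨fun h => hTB p' hp'T (h ▸ haB), Finset.mem_filter.2 ⟨Finset.mem_univ _, ?_⟩⟩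
        have h := hut p' hp'T
        rwa [hp'a] at h
      have hmem : a ∈ (Finset.univ : Finset (Plaquette d L)).filter (fun p => t a ∈ ({(p.1, p.2.1.1),
          (p.1.shift p.2.1.1, p.2.1.2), (p.1.shift p.2.1.2, p.2.1.1), (p.1, p.2.1.2)} :
            Finset (Edge d L))) := Finset.mem_filter.2 ⟨Finset.mem_univ _, ht a haB⟩
      have hle := card_filter_mem_plaquetteLinks_le (d := d) (L := L) (t a)
      calc (T.filter (fun p' => u p' = a)).card
          ≤ (((Finset.univ : Finset (Plaquette d L)).filter (fun p => t a ∈ ({(p.1, p.2.1.1),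
              (p.1.shift p.2.1.1, p.2.1.2), (p.1.shift p.2.1.2, p.2.1.1), (p.1, p.2.1.2)} :
                Finset (Edge d L)))).erase a).card := Finset.card_le_card hsub
        _ = ((Finset.univ : Finset (Plaquette d L)).filter (fun p => t a ∈ ({(p.1, p.2.1.1),
              (p.1.shift p.2.1.1, p.2.1.2), (p.1.shift p.2.1.2, p.2.1.1), (p.1, p.2.1.2)} :
                Finset (Edge d L)))).card - 1 := Finset.card_erase_of_mem hmem
        _ ≤ 2 * (d - 1) - 1 := Nat.sub_le_sub_right hle 1
    calc T.card = ∑ a ∈ T.image u, (T.filter (fun p' => u p' = a)).card :=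
          Finset.card_eq_sum_card_fiberwise fun p' hp' => Finset.mem_image_of_mem u hp'
      _ ≤ ∑ a ∈ T.image u, (2 * (d - 1) - 1) := Finset.sum_le_sum hfib
      _ = (2 * (d - 1) - 1) * (T.image u).card := by rw [Finset.sum_const, smul_eq_mul, mul_comm]

/-! ## §3 Block-optimal structures -/

/-- **An optimal structure of a block has a closing section inside the block with
`#(K ∖ B) ≤ (2d−3)·s`** (for a refined, injective rank of the same `(B, t)`). [ours] -/
theorem exists_closingSection_of_blockOptimal (K B : Finset (Plaquette d L)) (hBK : B ⊆ K)
    (t : Plaquette d L → Edge d L)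
    (ht : ∀ p ∈ B, t p ∈ ({(p.1, p.2.1.1), (p.1.shift p.2.1.1, p.2.1.2),
        (p.1.shift p.2.1.2, p.2.1.1), (p.1, p.2.1.2)} : Finset (Edge d L)))
    (rank : Plaquette d L → ℕ)
    (hrank : ∀ p ∈ B, ∀ p' ∈ B, p ≠ p' → t p ∈ ({(p'.1, p'.2.1.1), (p'.1.shift p'.2.1.1, p'.2.1.2),
        (p'.1.shift p'.2.1.2, p'.2.1.1), (p'.1, p'.2.1.2)} : Finset (Edge d L)) → rank p < rank p')
    (hopt : ∀ (B' : Finset (Plaquette d L)) (t' : Plaquette d L → Edge d L) (rank' : Plaquette d L → ℕ),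
      B' ⊆ K →
      (∀ p ∈ B', t' p ∈ ({(p.1, p.2.1.1), (p.1.shift p.2.1.1, p.2.1.2),
        (p.1.shift p.2.1.2, p.2.1.1), (p.1, p.2.1.2)} : Finset (Edge d L))) →
      (∀ p ∈ B', ∀ p' ∈ B', p ≠ p' → t' p ∈ ({(p'.1, p'.2.1.1), (p'.1.shift p'.2.1.1, p'.2.1.2),
        (p'.1.shift p'.2.1.2, p'.2.1.1), (p'.1, p'.2.1.2)} : Finset (Edge d L)) → rank' p < rank' p') →
      (K \ B).card ≤ (K \ B').card) :
    ∃ (rank' : Plaquette d L → ℕ) (S : Finset (Plaquette d L)) (u : Plaquette d L → Plaquette d L),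
      (∀ p ∈ B, ∀ p' ∈ B, p ≠ p' → t p ∈ ({(p'.1, p'.2.1.1), (p'.1.shift p'.2.1.1, p'.2.1.2),
        (p'.1.shift p'.2.1.2, p'.2.1.1), (p'.1, p'.2.1.2)} : Finset (Edge d L)) → rank' p < rank' p') ∧
      (∀ p' ∈ S, p' ∈ K) ∧ (∀ p' ∈ S, p' ∉ B) ∧ (∀ p' ∈ S, u p' ∈ B) ∧
      (∀ p' ∈ S, t (u p') ∈ ({(p'.1, p'.2.1.1), (p'.1.shift p'.2.1.1, p'.2.1.2),
        (p'.1.shift p'.2.1.2, p'.2.1.1), (p'.1, p'.2.1.2)} : Finset (Edge d L))) ∧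
      (∀ p' ∈ S, ∀ p ∈ B, p ≠ u p' → t p ∈ ({(p'.1, p'.2.1.1), (p'.1.shift p'.2.1.1, p'.2.1.2),
        (p'.1.shift p'.2.1.2, p'.2.1.1), (p'.1, p'.2.1.2)} : Finset (Edge d L)) → rank' p < rank' (u p')) ∧
      Set.InjOn u S ∧ (K \ B).card ≤ (2 * (d - 1) - 1) * S.card := by
  classical
  obtain ⟨rank', hinj', hrank'⟩ := exists_injective_rank B t rank hrank
  obtain ⟨S, u, h0, h1, h2, h3, h4, h5, h6⟩ := exists_closingSection_block K B t ht rank' (hinj'.injOn)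
  have hT : (K \ B).filter (fun p' => ∃ p ∈ B, t p ∈ ({(p'.1, p'.2.1.1),
      (p'.1.shift p'.2.1.1, p'.2.1.2), (p'.1.shift p'.2.1.2, p'.2.1.1), (p'.1, p'.2.1.2)} :
        Finset (Edge d L))) = K \ B :=
    Finset.filter_true_of_mem fun p' hp' =>
      exists_topLink_mem_of_blockOptimal K B hBK t ht rank hrank hopt (Finset.mem_sdiff.1 hp').1
        (Finset.mem_sdiff.1 hp').2
  rw [hT] at h6
  exact ⟨rank', S, u, hrank', h0, h1, h2, h3, h4, h5, h6⟩

/-- **The box of `(ℤ/L)³`: an optimal structure (`(R−1)³` box plaquettes outside — one per unit cube) with a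
closing section inside the box, `(R−1)³ ≤ 3s`** (`1 ≤ R`, `R + 1 ≤ L`). [ours] -/
theorem exists_boxOptimal_closingSection_three {R : ℕ} (hR : 1 ≤ R) (hRL : R + 1 ≤ L)
    (K : Finset (Plaquette 3 L))
    (hK : K = Finset.univ.filter (fun p : Plaquette 3 L =>
      (∀ m : Fin 3, (p.1 m).val < R) ∧ (p.1 p.2.1.1).val + 1 < R ∧ (p.1 p.2.1.2).val + 1 < R)) :
    ∃ (B : Finset (Plaquette 3 L)) (t : Plaquette 3 L → Edge 3 L) (rank : Plaquette 3 L → ℕ)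
      (S : Finset (Plaquette 3 L)) (u : Plaquette 3 L → Plaquette 3 L),
      B ⊆ K ∧
      (∀ p ∈ B, t p ∈ ({(p.1, p.2.1.1), (p.1.shift p.2.1.1, p.2.1.2),
        (p.1.shift p.2.1.2, p.2.1.1), (p.1, p.2.1.2)} : Finset (Edge 3 L))) ∧
      (∀ p ∈ B, ∀ p' ∈ B, p ≠ p' → t p ∈ ({(p'.1, p'.2.1.1), (p'.1.shift p'.2.1.1, p'.2.1.2),
        (p'.1.shift p'.2.1.2, p'.2.1.1), (p'.1, p'.2.1.2)} : Finset (Edge 3 L)) → rank p < rank p') ∧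
      (∀ p' ∈ S, p' ∈ K) ∧ (∀ p' ∈ S, p' ∉ B) ∧ (∀ p' ∈ S, u p' ∈ B) ∧
      (∀ p' ∈ S, t (u p') ∈ ({(p'.1, p'.2.1.1), (p'.1.shift p'.2.1.1, p'.2.1.2),
        (p'.1.shift p'.2.1.2, p'.2.1.1), (p'.1, p'.2.1.2)} : Finset (Edge 3 L))) ∧
      (∀ p' ∈ S, ∀ p ∈ B, p ≠ u p' → t p ∈ ({(p'.1, p'.2.1.1), (p'.1.shift p'.2.1.1, p'.2.1.2),
        (p'.1.shift p'.2.1.2, p'.2.1.1), (p'.1, p'.2.1.2)} : Finset (Edge 3 L)) → rank p < rank (u p')) ∧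
      Set.InjOn u S ∧ (K \ B).card = (R - 1) ^ 3 ∧ (R - 1) ^ 3 ≤ 3 * S.card := by
  obtain ⟨⟨B, t, rank, hBK, ht, hrank, hk⟩, hmin⟩ := isLeast_card_compl_ranked_box_three (L := L) hR hRL K hK
  have hopt : ∀ (B' : Finset (Plaquette 3 L)) (t' : Plaquette 3 L → Edge 3 L) (rank' : Plaquette 3 L → ℕ),
      B' ⊆ K →
      (∀ p ∈ B', t' p ∈ ({(p.1, p.2.1.1), (p.1.shift p.2.1.1, p.2.1.2),
        (p.1.shift p.2.1.2, p.2.1.1), (p.1, p.2.1.2)} : Finset (Edge 3 L))) →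
      (∀ p ∈ B', ∀ p' ∈ B', p ≠ p' → t' p ∈ ({(p'.1, p'.2.1.1), (p'.1.shift p'.2.1.1, p'.2.1.2),
        (p'.1.shift p'.2.1.2, p'.2.1.1), (p'.1, p'.2.1.2)} : Finset (Edge 3 L)) → rank' p < rank' p') →
      (K \ B).card ≤ (K \ B').card := by
    intro B' t' rank' hB'K ht' hrank'
    rw [hk]
    exact hmin ⟨B', t', rank', hB'K, ht', hrank', rfl⟩
  obtain ⟨rank', S, u, hrank', h0, h1, h2, h3, h4, h5, h6⟩ :=
    exists_closingSection_of_blockOptimal K B hBK t ht rank hrank hopt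
  have e2 : 2 * (3 - 1) - 1 = 3 := by norm_num
  rw [e2, hk] at h6
  exact ⟨B, t, rank', S, u, hBK, ht, hrank', h0, h1, h2, h3, h4, h5, hk, h6⟩

end Summit.Ventures.LatticeQCDFlow.Theory2.Autoregressive
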